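import Mathlib
import Summits.NavierStokesRegularity.NavierStokesRegularity.Theorems.TaoLadderRungTwoBreakOneShiftWindowStepDeviation
import HarnessLib

/-!
# The one-shift window system, XXIX: THE A-PRIORI HULL OF A ROUGH RUN BY CONTINUATION — the Kapela–Zgliczyński
# deviation bound of part XVII WITHOUT assuming the rough run stays in the hull: a strict margin around the
# centre companion turns the bound into its own a-priori enclosure (cell harvest/h2-tao-ladder, seat p2;
# rung1/KERNEL-CHEAP-REPLAY-SPEC.md §2 (d) (inclusion widening `U′ = U + 2Δ⁰`, continuation test `Δ¹ ≤ 2Δ⁰`),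
# §3 S1, §7 (O1); support for K1(1) = `NoSurvivingDSSOne`, stmt-NavierStokesRegularity-20205)

MODEL lattice ODEs only (Tao 2016 §4 normal form on Tao's shift set `S`); nothing here is a statement about
the Navier–Stokes equations; no item is closed; nothing numerical is proved. Generic in the index type `ι`; the
fields are abstract.

Part XVII `abs_stepDeviation_le` bounds the deviation `|S(t) − C(t)| ≤ Ẑ` of a run `S` of the rough field
`f t` from the run `C` of the centre field `fc` with the same start, PROVIDED both stay in the convex hull
`Hs` where the Jacobian and field-deviation bounds hold. For the centre run this is the output of the centre
step (part XXVIII); for the rough run it is exactly what one wants to conclude. The engine's device (SPEC §2 (d))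
is a margin: if every point within `Ẑ` of the centre run is an INTERIOR point of `Hs`, a continuation
("real induction") argument closes the loop.

* `gronwallBound_mono_time` — `t ↦ gronwallBound 0 K 1 t = ∫₀ᵗ e^{K r} dr` is monotone on `t ≥ 0` (any sign
  of `K`), so the weights `E` of a step serve every initial segment;
* `stepDeviation_bootstrap` — **hypotheses of part XVII except the hull membership of `S`, plus: `Hs` closed,
  `C(t) ∈ Hs` on `[0, h]`, and the margin `∀ t ∈ [0, h], ∀ y, |y − C(t)| ≤ Ẑ ⇒ Hs ∈ 𝓝 y`; conclusion: `S(t) ∈ Hs`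
  AND `|S(t) − C(t)|_i ≤ Ẑ_i` for all `t ∈ [0, h]`** — the (O1) a-priori enclosure of every inclusion
  realisation from the step data (`Hs = U′`, `Ẑ = Δ_s`).
-/

noncomputable section

-- the sub-problem namespace repeats the summit name by design (D-0017)
set_option linter.dupNamespace false

namespace Summit.NavierStokesRegularity.NavierStokesRegularity.Theorems

namespace DSSOneShift

open Set Metric Filter Topology Literature.Analysis.ODE

variable {ι : Type*} [Fintype ι] [DecidableEq ι]

omit [Fintype ι] [DecidableEq ι] in
/-- `gronwallBound 0 K 1 t = ∫₀ᵗ e^{K r} dr` is monotone in `t ≥ 0`, for any sign of `K`. [folklore] -/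
theorem gronwallBound_mono_time {K x y : ℝ} (hxy : x ≤ y) : gronwallBound 0 K 1 x ≤ gronwallBound 0 K 1 y := by
  by_cases hK : K = 0
  · simp only [hK, gronwallBound_K0, zero_add, one_mul]; exact hxy
  · simp only [gronwallBound_of_K_ne_0 hK, zero_mul, zero_add]
    rcases lt_or_gt_of_ne hK with hneg | hpos
    · have hexp : Real.exp (K * y) ≤ Real.exp (K * x) :=
        Real.exp_le_exp.2 (mul_le_mul_of_nonpos_left hxy hneg.le)
      have hk : 1 / K ≤ 0 := by rw [one_div]; exact (inv_lt_zero.2 hneg).le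
      exact mul_le_mul_of_nonpos_left (by linarith) hk
    · have hexp : Real.exp (K * x) ≤ Real.exp (K * y) :=
        Real.exp_le_exp.2 (mul_le_mul_of_nonneg_left hxy hpos.le)
      have hk : 0 ≤ 1 / K := by rw [one_div]; exact (inv_pos.2 hpos).le
      exact mul_le_mul_of_nonneg_left (by linarith) hk

/-- **THE A-PRIORI HULL OF A ROUGH RUN BY CONTINUATION.** See the module docstring.
[cite: KapelaZgliczynski2009, §4 Lemma 4.1 (componentwise estimates); Moore1979, §8.1 eq. (8.13) (continuation of an a-priori enclosure); cell vocabulary, harvest/h2-tao-ladder rung1/KERNEL-CHEAP-REPLAY-SPEC.md §2 (d)] -/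
theorem stepDeviation_bootstrap {h : ℝ} (hh : 0 ≤ h) {Hs : Set (ι → ℝ)} (hHs : Convex ℝ Hs) (hHcl : IsClosed Hs)
    {f : ℝ → (ι → ℝ) → ι → ℝ} {fc : (ι → ℝ) → ι → ℝ} {fc' : (ι → ℝ) → (ι → ℝ) →L[ℝ] (ι → ℝ)}
    {S C : ℝ → ι → ℝ}
    (hS : ∀ t ∈ Icc 0 h, HasDerivWithinAt S (f t (S t)) (Icc 0 h) t)
    (hC : ∀ t ∈ Icc 0 h, HasDerivWithinAt C (fc (C t)) (Icc 0 h) t) (h0 : S 0 = C 0)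
    (hCmem : ∀ t ∈ Icc 0 h, C t ∈ Hs)
    {dg cb Zb E ζ : ι → ℝ} {R : ι → ι → ℝ}
    (hmargin : ∀ t ∈ Icc 0 h, ∀ y : ι → ℝ, (∀ i, |y i - C t i| ≤ Zb i) → Hs ∈ 𝓝 y)
    (hfc : ∀ x ∈ Hs, HasFDerivWithinAt fc (fc' x) Hs x)
    (hdg : ∀ x ∈ Hs, ∀ i, (fc' x) (Pi.single i 1) i ≤ dg i)
    (hR0 : ∀ i j, 0 ≤ R i j) (hR : ∀ x ∈ Hs, ∀ i j, i ≠ j → |(fc' x) (Pi.single j 1) i| ≤ R i j)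
    (hcb : ∀ i, 0 ≤ cb i) (hδ : ∀ t ∈ Ico 0 h, ∀ x ∈ Hs, ∀ i, |f t x i - fc x i| ≤ cb i)
    (hZb : ∀ i, 0 ≤ Zb i) (hE : ∀ i, gronwallBound 0 (dg i) 1 h ≤ E i)
    (hfix : ∀ i, ((∑ j, R i j * Zb j) + cb i) * E i ≤ Zb i)
    (hζ0 : ∀ i, 0 < ζ i) (hζ : ∀ i, (∑ j, R i j * ζ j) * E i ≤ ζ i) :
    ∀ t ∈ Icc 0 h, S t ∈ Hs ∧ ∀ i, |S t i - C t i| ≤ Zb i := by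
  classical
  have hSc : ContinuousOn S (Icc 0 h) := fun t ht => (hS t ht).continuousWithinAt
  -- part XVII on an initial segment `[0, x]` on which `S` is known to stay in the hull
  have hdev : ∀ x ∈ Icc 0 h, (∀ s ∈ Ico 0 x, S s ∈ Hs) → ∀ t ∈ Icc 0 x, ∀ i, |S t i - C t i| ≤ Zb i := by
    intro x hx hin
    exact abs_stepDeviation_le hx.1 hHs (f := f) (fc := fc) (fc' := fc') (S := S) (C := C)
      (fun t ht => (hS t ⟨ht.1, ht.2.trans hx.2⟩).mono (Icc_subset_Icc_right hx.2))
      (fun t ht => (hC t ⟨ht.1, ht.2.trans hx.2⟩).mono (Icc_subset_Icc_right hx.2)) h0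
      (fun t ht => ⟨hin t ht, hCmem t ⟨ht.1, ht.2.le.trans hx.2⟩⟩) hfc hdg hR0 hR hcb
      (fun t ht y hy i => hδ t ⟨ht.1, ht.2.trans_le hx.2⟩ y hy i) hZb
      (fun i => (gronwallBound_mono_time hx.2).trans (hE i)) hfix hζ0 hζ
  -- the hereditary set
  set A : Set ℝ := {x | ∀ s, 0 ≤ s → s ≤ x → s ≤ h → S s ∈ Hs} with hA
  have hS0 : S 0 ∈ Hs := by rw [h0]; exact hCmem 0 ⟨le_rfl, hh⟩
  have h0A : (0 : ℝ) ∈ A := fun s hs0 hs1 _ => by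
    obtain rfl : s = 0 := le_antisymm hs1 hs0
    exact hS0
  -- the set of times at which `S` is in the hull is closed in `[0, h]`
  have hPcl : IsClosed (Icc 0 h ∩ S ⁻¹' Hs) := hSc.preimage_isClosed_of_isClosed isClosed_Icc hHcl
  -- closedness of `A ∩ [0, h]`
  have hAcl : IsClosed (A ∩ Icc 0 h) := by
    refine isClosed_of_closure_subset fun x hx => ?_
    have hxI : x ∈ Icc 0 h := closure_minimal inter_subset_right isClosed_Icc hx
    refine ⟨fun s hs0 hsx hsh => ?_, hxI⟩
    rcases lt_or_eq_of_le hsx with hlt | rfl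
    · -- some point of `A` lies above `s`
      obtain ⟨x', hx'A, hx's⟩ : ∃ x' ∈ A ∩ Icc 0 h, s < x' := by
        have hmem := mem_closure_iff_nhds.1 hx (Ioi s) (Ioi_mem_nhds hlt)
        obtain ⟨x', hx'1, hx'2⟩ := hmem
        exact ⟨x', hx'2, hx'1⟩
      exact hx'A.1 s hs0 hx's.le hsh
    · -- `s = x`: closedness of the membership set
      have hsub : A ∩ Icc 0 h ⊆ Icc 0 h ∩ S ⁻¹' Hs := fun x' hx' => ⟨hx'.2, hx'.1 x' hx'.2.1 le_rfl hx'.2.2⟩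
      exact (closure_minimal hsub hPcl hx).2
  -- push to the right from a point of `A`
  have hpush : ∀ x ∈ A ∩ Ico 0 h, A ∈ 𝓝[>] x := by
    rintro x ⟨hxA, hx⟩
    have hxI : x ∈ Icc 0 h := Ico_subset_Icc_self hx
    have hdx := hdev x hxI (fun s hs => hxA s hs.1 hs.2.le (hs.2.le.trans hxI.2)) x ⟨hx.1, le_rfl⟩
    have hnh : Hs ∈ 𝓝 (S x) := hmargin x hxI (S x) hdx
    -- continuity within `[0, h]` at `x`
    have hev : ∀ᶠ t in 𝓝[Icc 0 h] x, S t ∈ Hs := (hSc x hxI) hnh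
    obtain ⟨ε, hε, hball⟩ := Metric.eventually_nhds_iff.1 (eventually_nhdsWithin_iff.1 hev)
    have hIoo : Ioo x (x + ε) ∈ 𝓝[>] x := Ioo_mem_nhdsGT (by linarith)
    refine mem_of_superset hIoo fun x' hx' s hs0 hsx' hsh => ?_
    rcases le_or_gt s x with hsx | hxs
    · exact hxA s hs0 hsx hsh
    · refine hball ?_ ⟨hs0, hsh⟩
      rw [Real.dist_eq, abs_lt]
      constructor <;> linarith [hx'.2]
  -- real induction
  have hAll : Icc 0 h ⊆ A := IsClosed.Icc_subset_of_forall_mem_nhdsWithin hAcl h0A hpush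
  have hmemS : ∀ t ∈ Icc 0 h, S t ∈ Hs := fun t ht => hAll ht t ht.1 le_rfl ht.2
  intro t ht
  exact ⟨hmemS t ht, hdev h ⟨hh, le_rfl⟩ (fun s hs => hmemS s (Ico_subset_Icc_self hs)) t ht⟩

end DSSOneShift

end Summit.NavierStokesRegularity.NavierStokesRegularity.Theorems
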